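import Mathlib
import Summits.ValiantsHypothesis.ValiantsHypothesis.Theorems.BarrierLeverPartitionMinorsHitByVPAdditiveDoor

/-!
# Route BarrierLever — item `PartitionMinorsHitByVP` (stmt-ValiantsHypothesis-19717):
# the BLIND SPOT of the additive door — the Hilbert-function obstruction (kernel form)

Helper file (`--supports stmt-ValiantsHypothesis-19717`; cell valiant-natproofs, rung V4, 𝒟-side,
prover seat val-np-p6 gen 3). Definition-free. Closes NO item.

The additive door (`…AdditiveDoor.partitionMinor_hit_of_additive_mem`, p506404) hits `(u, w)` as soon as SOME
table `(ω₀, ω)` makes `det [∏_{c ∈ w j} (ω₀ c + Σ_{a ∈ u i} ω a c)]_{ij} ≠ 0`. This file proves the one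
known reason why NO table can work. Write `C₀` for a common core of the columns (`C₀ ⊆ w j` for all `j`)
and `ℓ_c(S) = ω₀ c + Σ_{a∈S} ω a c`. A column `j` with `|w j ∖ C₀| ≤ d` is, as a function of the row
`i`, `(∏_{c∈C₀} ℓ_c(u i)) · p_j(1_{u i})` with `p_j` a polynomial of degree `≤ d` in the 0/1 vector of
`u i`; hence all such columns lie in `D · V_d`, `V_d = span {i ↦ [R ⊆ u i] : |R| ≤ d}`, a space of
dimension `H_u(d) := rank [ [R ⊆ u i] ]_{i, |R| ≤ d}` (the affine Hilbert function of the row family).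

* `prod_affine_mem_span_indicators` — `i ↦ ∏_{c∈T} ℓ_c(u i)` lies in `span {i ↦ [R ⊆ u i] : |R| ≤ |T|}`.
* **`additiveMatrix_det_eq_zero_of_hilbert`** — if MORE than `H_u(d)` columns have `|w j ∖ C₀| ≤ d`, the
  additive matrix is singular for EVERY table.
* **`additiveWitness_layout_det_eq_zero_of_hilbert`** — hence the additive witness
  `∏_c(1+ω₀ c y_c)·∏_a(1+x_a ∏_c(1+ω a c y_c))` (p505605's `coeff_additiveWitness`) has a singular layout
  matrix on `(u, w)` for every table. Smallest instance: `h = 3`, rows `{∅,{0},{1},{0,1}}` (a parallelogram: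
  `H_u(1) = 3`), columns `{∅,{0},{1},{2}}` (four columns of weight `≤ 1`): the mirror witness (x ↔ y,
  `…OrProjections.partitionMinor_hit_symm`) is needed there — and suffices.

This is the NECESSITY half of the seat's conjecture H1 («the Hilbert condition is also sufficient for a
generic table»); for cube columns `w = 2^B` the condition always holds (a down-set of `2^k` monomials has
`≥ C(k,≤d)` members of degree `≤ d`), consistent with CLAIM U. WHAT THIS IS NOT: no sufficiency; nothing
on crux 14610 or VP vs VNP.
-/

set_option linter.dupNamespace false

namespace Summit.ValiantsHypothesis.ValiantsHypothesis.Theorems.BarrierLever.AdditiveDoor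

open Finset MvPolynomial

noncomputable section

variable {h : ℕ}

/-! ## 1. Products of affine functions of a 0/1 vector are combinations of inclusion indicators -/

/-- For every `T`, the row function `i ↦ ∏_{c ∈ T} (ω₀ c + Σ_{a ∈ u i} ω a c)` lies in the span of the
inclusion indicators `i ↦ [R ⊆ u i]` over the sets `R` with `|R| ≤ |T|`. -/
theorem prod_affine_mem_span_indicators {ι : Type*} (u : ι → Finset (Fin h)) (ω₀ : Fin h → ℂ)
    (ω : Fin h → Fin h → ℂ) (T : Finset (Fin h)) :
    (fun i => ∏ c ∈ T, (ω₀ c + ∑ a ∈ u i, ω a c)) ∈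
      Submodule.span ℂ (Set.range fun R : {R : Finset (Fin h) // R.card ≤ T.card} =>
        fun i => if R.1 ⊆ u i then (1 : ℂ) else 0) := by
  classical
  induction T using Finset.induction_on with
  | empty =>
    refine Submodule.subset_span ⟨⟨∅, by simp⟩, ?_⟩
    funext i
    simp
  | insert c T hc ih =>
    -- the span for `T` maps into the span for `insert c T` under multiplication by `ℓ_c(u i)`
    have hstep : ∀ v : ι → ℂ, v ∈ Submodule.span ℂ (Set.range fun R : {R : Finset (Fin h) //
        R.card ≤ T.card} => fun i => if R.1 ⊆ u i then (1 : ℂ) else 0) →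
        (fun i => (ω₀ c + ∑ a ∈ u i, ω a c) * v i) ∈ Submodule.span ℂ (Set.range
          fun R : {R : Finset (Fin h) // R.card ≤ (insert c T).card} =>
            fun i => if R.1 ⊆ u i then (1 : ℂ) else 0) := by
      intro v hv
      refine Submodule.span_induction (p := fun v _ => (fun i => (ω₀ c + ∑ a ∈ u i, ω a c) * v i) ∈
        Submodule.span ℂ (Set.range fun R : {R : Finset (Fin h) // R.card ≤ (insert c T).card} =>
          fun i => if R.1 ⊆ u i then (1 : ℂ) else 0)) ?_ ?_ ?_ ?_ hv
      · rintro _ ⟨R, rfl⟩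
        -- generator: [R ⊆ u i] · ℓ_c(u i) = ω₀ c [R ⊆ u i] + Σ_a ω a c [insert a R ⊆ u i]
        have hRcard : R.1.card ≤ (insert c T).card :=
          R.2.trans (Finset.card_le_card (Finset.subset_insert c T))
        have hRa : ∀ a, (insert a R.1).card ≤ (insert c T).card := fun a => by
          rw [Finset.card_insert_of_notMem hc]
          exact (Finset.card_insert_le a R.1).trans (Nat.succ_le_succ R.2)
        have hfun : (fun i => (ω₀ c + ∑ a ∈ u i, ω a c) * (if R.1 ⊆ u i then (1 : ℂ) else 0)) =
            ω₀ c • (fun i => if R.1 ⊆ u i then (1 : ℂ) else 0) +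
              ∑ a : Fin h, ω a c • (fun i => if insert a R.1 ⊆ u i then (1 : ℂ) else 0) := by
          funext i
          simp only [Pi.add_apply, Finset.sum_apply, Pi.smul_apply, smul_eq_mul]
          by_cases hR : R.1 ⊆ u i
          · rw [if_pos hR, mul_one]
            congr 1
            · simp
            · rw [← Finset.sum_filter_add_sum_filter_not Finset.univ (fun a => a ∈ u i)]
              have h1 : ∑ a ∈ Finset.univ.filter (fun a => a ∈ u i), ω a c *
                  (if insert a R.1 ⊆ u i then (1 : ℂ) else 0) = ∑ a ∈ u i, ω a c := by
                rw [show Finset.univ.filter (fun a => a ∈ u i) = u i from by ext a; simp]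
                refine Finset.sum_congr rfl fun a ha => ?_
                rw [if_pos (Finset.insert_subset ha hR), mul_one]
              have h2 : ∑ a ∈ Finset.univ.filter (fun a => ¬ a ∈ u i), ω a c *
                  (if insert a R.1 ⊆ u i then (1 : ℂ) else 0) = 0 := by
                refine Finset.sum_eq_zero fun a ha => ?_
                rw [Finset.mem_filter] at ha
                rw [if_neg (fun hins => ha.2 (hins (Finset.mem_insert_self a R.1))), mul_zero]
              rw [h1, h2, add_zero]
          · rw [if_neg hR, mul_zero]
            have h2 : ∀ a, (if insert a R.1 ⊆ u i then (1 : ℂ) else 0) = 0 := fun a =>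
              if_neg (fun hins => hR ((Finset.subset_insert a R.1).trans hins))
            simp [h2]
        rw [hfun]
        refine Submodule.add_mem _ (Submodule.smul_mem _ _ (Submodule.subset_span ⟨⟨R.1, hRcard⟩, rfl⟩))
          (Submodule.sum_mem _ fun a _ => Submodule.smul_mem _ _
            (Submodule.subset_span ⟨⟨insert a R.1, hRa a⟩, rfl⟩))
      · have : (fun i => (ω₀ c + ∑ a ∈ u i, ω a c) * (0 : ι → ℂ) i) = 0 := by funext i; simp
        rw [this]; exact Submodule.zero_mem _
      · intro x y _ _ hx hy
        have : (fun i => (ω₀ c + ∑ a ∈ u i, ω a c) * (x + y) i) =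
            (fun i => (ω₀ c + ∑ a ∈ u i, ω a c) * x i) + fun i => (ω₀ c + ∑ a ∈ u i, ω a c) * y i := by
          funext i; simp [mul_add]
        rw [this]; exact Submodule.add_mem _ hx hy
      · intro r x _ hx
        have : (fun i => (ω₀ c + ∑ a ∈ u i, ω a c) * (r • x) i) =
            r • fun i => (ω₀ c + ∑ a ∈ u i, ω a c) * x i := by
          funext i; simp [mul_left_comm]
        rw [this]; exact Submodule.smul_mem _ _ hx
    have := hstep _ ih
    simp_rw [Finset.prod_insert hc]
    exact this

/-! ## 2. The obstruction -/

/-- **The Hilbert-function obstruction.** If more than `H_u(d) = rank [ [R ⊆ u i] ]_{i, |R| ≤ d}` columns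
have `|w j ∖ C₀| ≤ d` for a common core `C₀ ⊆ w j`, the additive matrix is singular for EVERY table. -/
theorem additiveMatrix_det_eq_zero_of_hilbert {ι : Type*} [Fintype ι] [DecidableEq ι]
    (u w : ι → Finset (Fin h)) (ω₀ : Fin h → ℂ) (ω : Fin h → Fin h → ℂ) (C₀ : Finset (Fin h))
    (hC : ∀ j, C₀ ⊆ w j) (d : ℕ)
    (hcount : (Matrix.of fun (i : ι) (R : {R : Finset (Fin h) // R.card ≤ d}) =>
        if R.1 ⊆ u i then (1 : ℂ) else 0).rank <
      (Finset.univ.filter fun j => (w j \ C₀).card ≤ d).card) :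
    (Matrix.of fun i j : ι => ∏ c ∈ w j, (ω₀ c + ∑ a ∈ u i, ω a c)).det = 0 := by
  classical
  set M : Matrix ι ι ℂ := Matrix.of fun i j : ι => ∏ c ∈ w j, (ω₀ c + ∑ a ∈ u i, ω a c) with hM
  set E : Matrix ι {R : Finset (Fin h) // R.card ≤ d} ℂ :=
    Matrix.of fun i R => if R.1 ⊆ u i then (1 : ℂ) else 0 with hE
  -- the span of the indicator columns and its image under the core multiplier
  set V : Submodule ℂ (ι → ℂ) := Submodule.span ℂ (Set.range E.col) with hV
  set Dmul : (ι → ℂ) →ₗ[ℂ] (ι → ℂ) :=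
    { toFun := fun v i => (∏ c ∈ C₀, (ω₀ c + ∑ a ∈ u i, ω a c)) * v i
      map_add' := fun x y => by funext i; simp [mul_add]
      map_smul' := fun r x => by funext i; simp [mul_left_comm] } with hDmul
  set V' : Submodule ℂ (ι → ℂ) := V.map Dmul with hV'
  have hrankV : Module.finrank ℂ V = E.rank := (Matrix.rank_eq_finrank_span_cols E).symm
  have hrankV' : Module.finrank ℂ V' ≤ E.rank := hrankV ▸ Submodule.finrank_map_le _ _
  -- every low-weight column of `M` lies in `V'`
  have hcol : ∀ j : {j : ι // (w j \ C₀).card ≤ d}, M.col j.1 ∈ V' := by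
    intro j
    have hmem := prod_affine_mem_span_indicators u ω₀ ω (w j.1 \ C₀)
    -- transport the span over `{R // card ≤ |w j \ C₀|}` into `V` (cards `≤ d`)
    have hsub : Submodule.span ℂ (Set.range fun R : {R : Finset (Fin h) // R.card ≤ (w j.1 \ C₀).card} =>
        fun i => if R.1 ⊆ u i then (1 : ℂ) else 0) ≤ V := by
      refine Submodule.span_le.mpr ?_
      rintro _ ⟨R, rfl⟩
      refine Submodule.subset_span ⟨⟨R.1, R.2.trans j.2⟩, ?_⟩
      funext i
      simp [hE, Matrix.col]
    have hv : (fun i => ∏ c ∈ w j.1 \ C₀, (ω₀ c + ∑ a ∈ u i, ω a c)) ∈ V := hsub hmem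
    have hcolj : M.col j.1 = Dmul (fun i => ∏ c ∈ w j.1 \ C₀, (ω₀ c + ∑ a ∈ u i, ω a c)) := by
      funext i
      simp only [hM, hDmul, Matrix.col_apply, Matrix.of_apply, LinearMap.coe_mk, AddHom.coe_mk]
      rw [← Finset.prod_union (Finset.disjoint_sdiff), Finset.union_sdiff_of_subset (hC j.1)]
    rw [hcolj]
    exact Submodule.mem_map_of_mem hv
  -- the linear map `v ↦ Σ_j v_j col_j` on `J → ℂ` lands in `V'`, which is too small
  let Φ : ({j : ι // (w j \ C₀).card ≤ d} → ℂ) →ₗ[ℂ] (ι → ℂ) :=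
    { toFun := fun v i => ∑ j : {j : ι // (w j \ C₀).card ≤ d}, v j * M i j.1
      map_add' := fun x y => by funext i; simp [add_mul, Finset.sum_add_distrib]
      map_smul' := fun r x => by funext i; simp [Finset.mul_sum, mul_assoc] }
  have hΦapply : ∀ v i, Φ v i = ∑ j : {j : ι // (w j \ C₀).card ≤ d}, v j * M i j.1 :=
    fun v i => rfl
  have hΦmem : ∀ v, Φ v ∈ V' := by
    intro v
    have : Φ v = ∑ j : {j : ι // (w j \ C₀).card ≤ d}, v j • M.col j.1 := by
      funext i
      rw [hΦapply]
      simp [Matrix.col_apply, Finset.sum_apply, smul_eq_mul]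
    rw [this]
    exact Submodule.sum_mem _ fun j _ => Submodule.smul_mem _ _ (hcol j)
  have hcardJ : Module.finrank ℂ ({j : ι // (w j \ C₀).card ≤ d} → ℂ) =
      (Finset.univ.filter fun j => (w j \ C₀).card ≤ d).card := by
    rw [Module.finrank_fintype_fun_eq_card, Fintype.card_subtype]
  have hker : LinearMap.ker (LinearMap.codRestrict V' Φ hΦmem) ≠ ⊥ := by
    refine LinearMap.ker_ne_bot_of_finrank_lt ?_
    rw [hcardJ]
    exact lt_of_le_of_lt hrankV' hcount
  obtain ⟨v, hvker, hvne⟩ := (Submodule.ne_bot_iff _).mp hker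
  have hΦv : Φ v = 0 := by
    have := congrArg Subtype.val (LinearMap.mem_ker.mp hvker)
    simpa using this
  -- extend `v` by zero and conclude
  refine (Matrix.exists_mulVec_eq_zero_iff).mp
    ⟨fun i => if hi : (w i \ C₀).card ≤ d then v ⟨i, hi⟩ else 0, ?_, ?_⟩
  · intro hzero
    apply hvne
    funext j
    have := congrFun hzero j.1
    simp only [dif_pos j.2, Pi.zero_apply] at this
    exact this
  · funext i
    have hi : ∑ j : {j : ι // (w j \ C₀).card ≤ d}, v j * M i j.1 = 0 := by
      rw [← hΦapply, hΦv]; rfl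
    rw [Matrix.mulVec, dotProduct, Pi.zero_apply]
    calc ∑ j, M i j * (if hj : (w j \ C₀).card ≤ d then v ⟨j, hj⟩ else 0)
        = ∑ j ∈ Finset.univ.filter (fun j => (w j \ C₀).card ≤ d),
            M i j * (if hj : (w j \ C₀).card ≤ d then v ⟨j, hj⟩ else 0) := by
          refine (Finset.sum_subset (Finset.filter_subset _ _) fun j _ hj => ?_).symm
          have hj' : ¬ (w j \ C₀).card ≤ d := by simpa using hj
          rw [dif_neg hj', mul_zero]
      _ = ∑ j : {j : ι // (w j \ C₀).card ≤ d},
            M i j.1 * (if hj : (w j.1 \ C₀).card ≤ d then v ⟨j.1, hj⟩ else 0) :=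
          Finset.sum_subtype _ (fun j => by simp) _
      _ = ∑ j : {j : ι // (w j \ C₀).card ≤ d}, v j * M i j.1 :=
          Fintype.sum_congr _ _ fun j => by rw [dif_pos j.2, mul_comm]
      _ = 0 := hi

/-- **The additive witness inherits the blind spot.** Under the Hilbert count condition, the layout
matrix of the additive witness `∏_c (1+ω₀ c y_c) · ∏_a (1 + x_a ∏_c (1+ω a c y_c))` on `(u, w)` is singular
for EVERY table (its entries ARE the additive matrix, `coeff_additiveWitness`). -/
theorem additiveWitness_layout_det_eq_zero_of_hilbert {ι : Type*} [Fintype ι] [DecidableEq ι]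
    (u w : ι → Finset (Fin h)) (ω₀ : Fin h → ℂ) (ω : Fin h → Fin h → ℂ) (C₀ : Finset (Fin h))
    (hC : ∀ j, C₀ ⊆ w j) (d : ℕ)
    (hcount : (Matrix.of fun (i : ι) (R : {R : Finset (Fin h) // R.card ≤ d}) =>
        if R.1 ⊆ u i then (1 : ℂ) else 0).rank <
      (Finset.univ.filter fun j => (w j \ C₀).card ≤ d).card) :
    (Matrix.of fun i j : ι => MvPolynomial.coeff
        (∑ a ∈ u i, Finsupp.single (Fin.castAdd h a) 1 +
          ∑ c ∈ w j, Finsupp.single (Fin.natAdd h c) 1)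
        ((∏ c : Fin h, (1 + C (ω₀ c) * X (Fin.natAdd h c))) *
          ∏ a : Fin h, (1 + X (Fin.castAdd h a) *
            ∏ c : Fin h, (1 + C (ω a c) * X (Fin.natAdd h c))) : MvPolynomial (Fin (h + h)) ℂ)).det = 0 := by
  have hmat : (Matrix.of fun i j : ι => MvPolynomial.coeff
        (∑ a ∈ u i, Finsupp.single (Fin.castAdd h a) 1 +
          ∑ c ∈ w j, Finsupp.single (Fin.natAdd h c) 1)
        ((∏ c : Fin h, (1 + C (ω₀ c) * X (Fin.natAdd h c))) *
          ∏ a : Fin h, (1 + X (Fin.castAdd h a) *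
            ∏ c : Fin h, (1 + C (ω a c) * X (Fin.natAdd h c))) : MvPolynomial (Fin (h + h)) ℂ)) =
      Matrix.of fun i j : ι => ∏ c ∈ w j, (ω₀ c + ∑ a ∈ u i, ω a c) := by
    ext i j
    rw [Matrix.of_apply, Matrix.of_apply, coeff_additiveWitness]
  rw [hmat]
  exact additiveMatrix_det_eq_zero_of_hilbert u w ω₀ ω C₀ hC d hcount

end

end Summit.ValiantsHypothesis.ValiantsHypothesis.Theorems.BarrierLever.AdditiveDoor
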